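import Summits.QuantumFields.BalabanUV.T4Continuum.Spine.NE3.PairLandauB8Avg
import Summits.QuantumFields.BalabanUV.T4Continuum.Support.AveragingDeficitTransport
import Literature.MathematicalPhysics.QuantumFieldTheory.Balaban1983to89.B8Eq184Proof
import Literature.MathematicalPhysics.QuantumFieldTheory.Balaban1983to89.B8Eq146AExpansion
import HarnessLib

/-!
# T⁴ programme, node NE3 (pub-ymgap DAG node N16) — THE LEFT-CHART ↔ END-FRAME DICTIONARY AT THE PAIR: [B8] Theorem 4's OUTPUT LETTERS
# («U₁ = U′^{u⁻¹} = e^{iηA}U₀», moving frame (1.17) = `B7Eq92Concrete.mgauge`, `B8Eq184Proof.cfgExp η A`, sup (1.62)∕(1.36) on `A`, gradient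
# letter `B8Ineq132.covDerivFwd`) VERSUS THE END's LETTERS (`gaugeAct u U_A = vary W Z 1`, `Z` END-framed, `LandauRepB8.sup ∕ grad`):
# `Z := Ad_{W(b)⁻¹}(iηA(b))` — exact identities for `rep ∕ skew ∕ per`, `‖Z‖ = η‖A‖`, and `‖covDiff W μ Z‖ ≤ η²‖∇^η_{W,μ}A‖ + 2·(plaquette
# radius of W)·η‖A‖` (`PairLeftChartB8`)

Cell `pub-ymgap`, HUMAN RULING D-0062, seat `pub-ymgap-dag-n16-b` (FIRST-MISSING-ESTIMATE for N16 = NE3; writer prover-pub-ymgap-dag-n16-b-g2-0,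
2026-08-26).  Companion of `Spine/NE3/PairThm4AtB8` ∕ `PairReg335B8` (the N05 → N16 edge BY NAME: [B8] Thm 4's typed interface applies at the
pair) and of `Spine/NE3/PairLandauB8(Avg)` (THE END's per-pair hypothesis `LandauRepB8Avg L N k W U_A u Z s₁ s₂ β`).

WHY.  Node N05's Theorem-4 files (`B8Thm4ExistsLocal.thm4_exists_step_local`, seat n05-a, 2026-08-26) deliver Theorem 4's conclusion in
PRINT's letters on the ℤᵈ carrier: a unitary `u` with (1.29), a configuration `W₁` with `mgauge U₀ u W₁ = U′` («U₁ = U′^{u⁻¹}», the moving-frame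
action (55) of [Balaban1985Averaging] = (1.17)), `Lan W₁` ((1.38), abstract there), and `W₁ = cfgExp η A′` with `A′` self-adjoint and
`‖A′‖ ≤ B′₁(α₀+α₁)(Lʲη)⁻¹` ((1.62)); Proposition 3 then bounds `∇^η_{U₀}A′` in the letter `B8Ineq132.covDerivFwd η U₀ μ (A′ · κ)`.  THE END reads
the representative in the RIGHT chart with END-framed direction: `gaugeAct u U_A = vary W Z 1 = W·e^{Z}`, `‖Z(b)‖ ≤ s₁ξ`, first covariant
differences `covDiff W μ Z ≤ s₁ξ²` (`PairLandauB8.LandauRepB8`).  This file is the kernel dictionary between the two, at any unitary background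
`W` (at the pair `W = rescale L (bavg L U_B)`, `U′U₀ = U_A^{u₀}`, `ξ = η = (Lᵏ)⁻¹`): nothing is estimated, letters are converted.

WHAT ([folklore]; 0 def, 0 sorry; `Z` is written out as `fun x μ => Ad (W x μ)⁻¹ (Y x μ)` with `Y = iEta η A′ = (iη)•A′`):
* §1 MOVING FRAME ↔ GAUGE ACTION: `mgauge U₀ u W₁ = pert U U₀ → W₁ * U₀ = gaugeAct u⁻¹ U` (`mul_eq_gaugeAct_inv_of_mgauge_eq_pert`; (55) «if we
  write V = V′V₀, then V^v = V′^vV₀»), and at the pair with `U = U_A^{u₀}`: `W₁ * W = gaugeAct (u⁻¹ * u₀) U_A`.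
* §2 LEFT CHART → END FRAME (exact): `vary W (Ad_{W⁻¹}Y) 1 = (e^{Y} · W)` bondwise (`vary_AdInv_eq_expMul`); `‖Ad_{W(b)⁻¹}Y(b)‖ = ‖Y(b)‖`;
  skew-adjointness and periodicity are preserved; `iEta`∕`cfgExp` letters: `cfgExp η A x μ = expUnit (iEta η A x μ)`, `‖iEta η A x μ‖ = η‖A x μ‖`,
  `iEta η A x μ ∈ 𝔲` for self-adjoint `A x μ`.
* §3 THE GRADIENT: `‖covDiff W μ (Ad_{W⁻¹}Y) x κ‖ ≤ ‖Ad_{W(x,μ)}Y(x+e_μ,κ) − Y(x,κ)‖ + 2‖W(∂p_{κμ}(x)) − 1‖·‖Y(x+e_μ,κ)‖` (`norm_covDiff_AdInv_le`;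
  the plaquette enters because the END transports along the bond `⟨x+e_κ, x+e_κ+e_μ⟩` and the left chart along `⟨x, x+e_μ⟩`), and in B8's letter
  `Ad_{W(x,μ)}(iEta η A)(x+e_μ,κ) − (iEta η A)(x,κ) = (iη·η)•covDerivFwd η W μ (A · κ) x`, norm `= η²‖covDerivFwd η W μ (A · κ) x‖`.
* §4 **`endFrame_of_leftChart`** — the package: from `gaugeAct v U_A = (cfgExp η A) * W` bondwise, `A` self-adjoint with `‖A x μ‖ ≤ s`,
  `‖covDerivFwd η W μ (A · κ) x‖ ≤ g`, `SmallField W a`, `W` unitary: the END-framed `Z` has `gaugeAct v U_A = vary W Z 1`, `IsSkewDir Z`,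
  `‖Z x μ‖ ≤ η·s`, `‖covDiff W μ Z x κ‖ ≤ η²·g + 2·a·η·s`; periodic data give periodic `Z` (`isPeriodicDir_AdInv`).  At the pair (`η = ξ`,
  `a = α_Wξ²`, `s = B′₁(α₀+α₁)`, `g = B₁(α₀+α₁)`): `LandauRepB8`'s `rep ∕ skew ∕ per ∕ sup ∕ grad` with `s₁ = max(B′₁, B₁ + 2α_WB′₁ξ)(α₀+α₁)`.
HONEST FRAMING (page 1): a dictionary; `landau` (1.38) waits for N05's concrete `Lan` (its `R(U₀)`∕`N(Q′(U₀))` versus the Spine's `avgKernelGauges`),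
`holder`∕`lap` for Prop 3's Hölder ∕ Laplacian letters, `dbar` is g0's `PairDbarB8`; (1.62)∕(1.36) for Bałaban's minimisers are N05's ([B8] Thm 4 ∕
Prop 3 at a curved background, NOT proved); Thm 2 ∕ NE3 NOT proved; spine 0∕9; finite T⁴ rung (B)+1 at fixed ε — NOT infinite volume, NOT mass gap,
NOT `BetaPertH`, NOT Clay.  PLACEMENT: `Spine/NE3/`.
-/

set_option autoImplicit false

open scoped BigOperators Matrix Matrix.Norms.L2Operator
open NormedSpace

namespace Summit.QuantumFields.BalabanUV.T4Continuum.NE3.PairLeftChartB8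

open Literature.MathematicalPhysics.QuantumFieldTheory.Balaban1983to89
open B7Prop1Explicit B7Prop2Explicit
open B7Eq92Concrete (Rc Rc_apply mgauge mgauge_mul expUnit_conj)
open B7Eq78Linearization (conjR)
open B8Lemma1NonAbelian (pert)
open B8Ineq132 (covDerivFwd)
open B8Eq184Proof (cfgExp)
open B8Eq146AExpansion (iEta)
open T4AveragingDeficitWall (IsUnitaryCfg SmallField Ad IsSkewDir vary)
open T4AveragingDeficitWallBoundary (IsPeriodicCfg)
open T4AveragingDeficitNonAbelian (Ad_mul Ad_sub)
open AveragingDeficitTransport (norm_Ad_of_unitary mem_U1_of_unitary Ad_mem_skewAdjoint)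
open AveragingDeficitPeriodicCounting (IsPeriodicDir)
open NE3.PairLandauB8 (covDiff)

noncomputable section

variable {d : ℕ} {n : Type*} [Fintype n] [DecidableEq n]

/-! ## §1 The moving frame (55)∕(1.17) versus the gauge action (8) -/

/-- **«if we write V = V′V₀, then V^v = V′^vV₀» READ BACKWARDS**: if the moving-frame transform of `W₁` by `u` is the perturbation `U·U₀⁻¹` of `U`
relative to `U₀` (`mgauge U₀ u W₁ = pert U U₀`, i.e. «U₁ := U′^{u⁻¹} = W₁» for `U′ = UU₀⁻¹`), then `W₁·U₀ = U^{u⁻¹}`. [folklore] -/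
theorem mul_eq_gaugeAct_inv_of_mgauge_eq_pert {G : Type*} [Group G] {U₀ U W₁ : Site d → Fin d → G} {u : Site d → G}
    (h : mgauge U₀ u W₁ = pert U U₀) : W₁ * U₀ = gaugeAct u⁻¹ U := by
  have h1 : mgauge U₀ u W₁ * U₀ = U := by
    rw [h]; funext x μ; simp [pert]
  have h2 : gaugeAct u (W₁ * U₀) = U := by rw [← mgauge_mul]; exact h1
  funext x μ
  have h3 := congrFun (congrFun h2 x) μ
  simp only [gaugeAct, Pi.inv_apply, inv_inv] at h3 ⊢
  rw [← h3]; group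

/-- AT THE PAIR: with `U = U_A^{u₀}` (the pinned axial pre-gauge) the configuration `W₁` of Theorem 4's conclusion satisfies
`W₁·W = U_A^{u⁻¹u₀}` — the END's `gaugeAct (u⁻¹ * u₀) U_A`. [folklore] -/
theorem mul_eq_gaugeAct_of_mgauge_eq_pert_gaugeAct {G : Type*} [Group G] {W UA W₁ : Site d → Fin d → G} {u u₀ : Site d → G}
    (h : mgauge W u W₁ = pert (gaugeAct u₀ UA) W) : W₁ * W = gaugeAct (u⁻¹ * u₀) UA := by
  rw [mul_eq_gaugeAct_inv_of_mgauge_eq_pert h]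
  funext x μ
  simp only [gaugeAct, Pi.inv_apply, Pi.mul_apply, mul_inv_rev, inv_inv, mul_assoc]

/-! ## §2 Left chart → END frame: the exact identities -/

/-- **`W·e^{Ad_{W⁻¹}Y} = e^{Y}·W`** bondwise: the END's right chart `vary W Z 1` with `Z = Ad_{W⁻¹}Y` IS the left chart `e^{Y}U₀` of
«U₁ = e^{iηA}U₀» ([Balaban1985Averaging] (57) `exp(XAX⁻¹) = R(X) exp A`). [folklore] -/
theorem vary_AdInv_eq_expMul (W : Site d → Fin d → (Matrix n n ℂ)ˣ) (Y : Site d → Fin d → Matrix n n ℂ) :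
    vary W (fun x μ => Ad (W x μ)⁻¹ (Y x μ)) 1 = fun x μ => expUnit (Y x μ) * W x μ := by
  funext x μ
  unfold vary
  rw [Complex.ofReal_one, one_smul]
  have h : expUnit (Ad (W x μ)⁻¹ (Y x μ)) = Rc (W x μ)⁻¹ (expUnit (Y x μ)) := by
    unfold Ad
    rw [inv_inv]
    have := expUnit_conj (W x μ)⁻¹ (Y x μ)
    rwa [inv_inv] at this
  rw [h, Rc_apply, inv_inv, ← mul_assoc, ← mul_assoc, mul_inv_cancel, one_mul]

/-- `‖Ad_{W(b)⁻¹}Y(b)‖ = ‖Y(b)‖` for unitary `W` (the operator norm is unitarily invariant). [folklore] -/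
theorem norm_AdInv (W : Site d → Fin d → (Matrix n n ℂ)ˣ) (hW : IsUnitaryCfg W) (Y : Site d → Fin d → Matrix n n ℂ)
    (x : Site d) (μ : Fin d) : ‖Ad (W x μ)⁻¹ (Y x μ)‖ = ‖Y x μ‖ :=
  norm_Ad_of_unitary ((unitaryUnits _).inv_mem (hW x μ)) _

/-- `Ad_{W⁻¹}` preserves `𝔲(N)`-valuedness. [folklore] -/
theorem isSkewDir_AdInv {W : Site d → Fin d → (Matrix n n ℂ)ˣ} (hW : IsUnitaryCfg W) {Y : Site d → Fin d → Matrix n n ℂ}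
    (hY : IsSkewDir Y) : IsSkewDir fun x μ => Ad (W x μ)⁻¹ (Y x μ) :=
  fun x μ => Ad_mem_skewAdjoint ((unitaryUnits _).inv_mem (hW x μ)) (hY x μ)

/-- Periodic data give a periodic END-framed direction. [folklore] -/
theorem isPeriodicDir_AdInv {W : Site d → Fin d → (Matrix n n ℂ)ˣ} {Y : Site d → Fin d → Matrix n n ℂ} {P : ℤ}
    (hW : IsPeriodicCfg W P) (hY : IsPeriodicDir Y P) : IsPeriodicDir (fun x μ => Ad (W x μ)⁻¹ (Y x μ)) P := by
  intro x κ μ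
  simp only [hW x κ μ, hY x κ μ]

/-- n05-a's letter: `cfgExp η A x μ = expUnit (iEta η A x μ)` (`e^{i(ηA)} = e^{(iη)A}`). [folklore] -/
theorem cfgExp_eq_expUnit_iEta (η : ℝ) (A : Site d → Fin d → Matrix n n ℂ) (x : Site d) (μ : Fin d) :
    cfgExp η A x μ = expUnit (iEta η A x μ) := by
  unfold cfgExp iEta
  congr 1
  rw [← Complex.coe_smul, smul_smul]

/-- `‖(iη)•A‖ = η‖A‖` for `η ≥ 0`. [folklore] -/
theorem norm_iEta {η : ℝ} (hη : 0 ≤ η) (A : Site d → Fin d → Matrix n n ℂ) (x : Site d) (μ : Fin d) :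
    ‖iEta η A x μ‖ = η * ‖A x μ‖ := by
  unfold iEta
  rw [norm_smul, norm_mul, Complex.norm_I, one_mul, Complex.norm_real, Real.norm_eq_abs, abs_of_nonneg hη]

/-- `(iη)•A` is `𝔲(N)`-valued for self-adjoint (`𝔤`-valued, print's convention) `A`. [folklore] -/
theorem isSkewDir_iEta (η : ℝ) {A : Site d → Fin d → Matrix n n ℂ} (hA : ∀ x μ, IsSelfAdjoint (A x μ)) : IsSkewDir (iEta η A) := by
  intro x μ
  unfold iEta
  refine IsSelfAdjoint.smul_mem_skewAdjoint ?_ (hA x μ)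
  show star ((Complex.I : ℂ) * η) = -((Complex.I : ℂ) * η)
  simp [Complex.conj_ofReal]

/-- `(iη)•A` is periodic when `A` is (in the configuration sense `IsPeriodicCfg`-style periodicity of a bond function). [folklore] -/
theorem isPeriodicDir_iEta (η : ℝ) {A : Site d → Fin d → Matrix n n ℂ} {P : ℤ} (hA : ∀ (x : Site d) (κ μ : Fin d), A (x + P • e κ) μ = A x μ) :
    IsPeriodicDir (iEta η A) P := by
  intro x κ μ
  simp only [iEta, hA x κ μ]

/-! ## §3 The gradient: END-frame covariant difference versus B8's forward covariant derivative -/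

/-- `‖PTP⁻¹ − T‖ ≤ 2‖P − 1‖·‖T‖ for `‖P‖, ‖P⁻¹‖ ≤ 1`. [folklore] -/
theorem norm_Ad_sub_self_le [Nonempty n] {P : (Matrix n n ℂ)ˣ} (hP : P ∈ U1 (Matrix n n ℂ)) (T : Matrix n n ℂ) :
    ‖Ad P T - T‖ ≤ 2 * ‖(P : Matrix n n ℂ) - 1‖ * ‖T‖ := by
  letI : CStarAlgebra (Matrix n n ℂ) := {}
  have h : Ad P T - T = ((P : Matrix n n ℂ) - 1) * T * ((P⁻¹ : (Matrix n n ℂ)ˣ) : Matrix n n ℂ) +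
      T * (((P⁻¹ : (Matrix n n ℂ)ˣ) : Matrix n n ℂ) - 1) := by
    unfold Ad; noncomm_ring
  rw [h]
  have h1 : ‖((P : Matrix n n ℂ) - 1) * T * ((P⁻¹ : (Matrix n n ℂ)ˣ) : Matrix n n ℂ)‖ ≤ ‖(P : Matrix n n ℂ) - 1‖ * ‖T‖ := by
    calc _ ≤ ‖((P : Matrix n n ℂ) - 1) * T‖ * ‖((P⁻¹ : (Matrix n n ℂ)ˣ) : Matrix n n ℂ)‖ := norm_mul_le _ _
      _ ≤ ‖((P : Matrix n n ℂ) - 1) * T‖ * 1 := by gcongr; exact hP.2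
      _ ≤ ‖(P : Matrix n n ℂ) - 1‖ * ‖T‖ := by rw [mul_one]; exact norm_mul_le _ _
  have h2 : ‖T * (((P⁻¹ : (Matrix n n ℂ)ˣ) : Matrix n n ℂ) - 1)‖ ≤ ‖T‖ * ‖(P : Matrix n n ℂ) - 1‖ :=
    (norm_mul_le _ _).trans (mul_le_mul_of_nonneg_left (norm_inv_sub_one_le hP) (norm_nonneg _))
  calc _ ≤ _ + _ := norm_add_le _ _
    _ ≤ ‖(P : Matrix n n ℂ) - 1‖ * ‖T‖ + ‖T‖ * ‖(P : Matrix n n ℂ) - 1‖ := add_le_add h1 h2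
    _ = 2 * ‖(P : Matrix n n ℂ) - 1‖ * ‖T‖ := by ring

/-- **THE END-FRAME COVARIANT DIFFERENCE OF `Z = Ad_{W⁻¹}Y` IN THE LEFT CHART**: exactly
`covDiff W μ Z x κ = Ad_{W(x,κ)⁻¹}[Ad_{W(∂p_{κμ}(x))}(Ad_{W(x,μ)}Y(x+e_μ,κ)) − Y(x,κ)]` — the END transports `Z(x+e_μ,κ)` (sitting at `x+e_μ+e_κ`)
back along `⟨x+e_κ, x+e_κ+e_μ⟩`, the left chart transports `Y(x+e_μ,κ)` (sitting at `x+e_μ`) back along `⟨x, x+e_μ⟩`; the two routes differ by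
the plaquette `p_{κμ}(x)`. [folklore] -/
theorem covDiff_AdInv_eq (W : Site d → Fin d → (Matrix n n ℂ)ˣ) (Y : Site d → Fin d → Matrix n n ℂ) (μ : Fin d) (x : Site d) (κ : Fin d) :
    covDiff W μ (fun x μ => Ad (W x μ)⁻¹ (Y x μ)) x κ =
      Ad (W x κ)⁻¹ (Ad (hol W x (plaqWord κ μ)) (Ad (W x μ) (Y (x + e μ) κ)) - Y x κ) := by
  have hP : hol W x (plaqWord κ μ) = W x κ * W (x + e κ) μ * (W (x + e μ) κ)⁻¹ * (W x μ)⁻¹ := by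
    rw [← lplaqWord_true, hol_lplaqWord]
    simp only [stepHol_true, Letter.vec_true]
  have key : W (x + e κ) μ * (W (x + e μ) κ)⁻¹ = (W x κ)⁻¹ * hol W x (plaqWord κ μ) * W x μ := by
    rw [hP]; group
  unfold covDiff
  dsimp only
  rw [Ad_sub, ← Ad_mul, ← Ad_mul, ← Ad_mul, key]

/-- **THE GRADIENT DICTIONARY**: for unitary `W` whose plaquette `p_{κμ}(x)` is within `a` of `1`,
`‖covDiff W μ (Ad_{W⁻¹}Y) x κ‖ ≤ ‖Ad_{W(x,μ)}Y(x+e_μ,κ) − Y(x,κ)‖ + 2a·‖Y(x+e_μ,κ)‖`. [folklore] -/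
theorem norm_covDiff_AdInv_le [Nonempty n] {W : Site d → Fin d → (Matrix n n ℂ)ˣ} (hW : IsUnitaryCfg W) (Y : Site d → Fin d → Matrix n n ℂ)
    (μ : Fin d) (x : Site d) (κ : Fin d) {a : ℝ} (ha : ‖((hol W x (plaqWord κ μ) : (Matrix n n ℂ)ˣ) : Matrix n n ℂ) - 1‖ ≤ a) :
    ‖covDiff W μ (fun x μ => Ad (W x μ)⁻¹ (Y x μ)) x κ‖ ≤ ‖Ad (W x μ) (Y (x + e μ) κ) - Y x κ‖ + 2 * a * ‖Y (x + e μ) κ‖ := by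
  letI : CStarAlgebra (Matrix n n ℂ) := {}
  have hU1 : ∀ x κ, W x κ ∈ U1 (Matrix n n ℂ) := fun x κ => mem_U1_of_unitary (hW x κ)
  have hPm : hol W x (plaqWord κ μ) ∈ U1 (Matrix n n ℂ) := hol_mem hU1 _ _
  rw [covDiff_AdInv_eq, norm_Ad_of_unitary ((unitaryUnits _).inv_mem (hW x κ))]
  have hsplit : Ad (hol W x (plaqWord κ μ)) (Ad (W x μ) (Y (x + e μ) κ)) - Y x κ =
      (Ad (hol W x (plaqWord κ μ)) (Ad (W x μ) (Y (x + e μ) κ)) - Ad (W x μ) (Y (x + e μ) κ)) + (Ad (W x μ) (Y (x + e μ) κ) - Y x κ) := by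
    abel
  rw [hsplit]
  have h1 := norm_Ad_sub_self_le hPm (Ad (W x μ) (Y (x + e μ) κ))
  rw [norm_Ad_of_unitary (hW x μ)] at h1
  have h2 : 2 * ‖((hol W x (plaqWord κ μ) : (Matrix n n ℂ)ˣ) : Matrix n n ℂ) - 1‖ * ‖Y (x + e μ) κ‖ ≤ 2 * a * ‖Y (x + e μ) κ‖ := by gcongr
  calc _ ≤ _ + _ := norm_add_le _ _
    _ ≤ _ := by linarith

/-- **B8's LETTER**: `Ad_{W(x,μ)}(iEta η A)(x+e_μ,κ) − (iEta η A)(x,κ) = (iη·η) • covDerivFwd η W μ (A · κ) x` (`η ≠ 0`) — the left-chart transported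
difference IS `η²` times B8's forward covariant derivative (1.1) of the bond function `A_κ` (up to the unit `i`). [folklore] -/
theorem Ad_iEta_sub_eq_covDerivFwd {η : ℝ} (hη : η ≠ 0) (W : Site d → Fin d → (Matrix n n ℂ)ˣ) (A : Site d → Fin d → Matrix n n ℂ)
    (μ : Fin d) (x : Site d) (κ : Fin d) :
    Ad (W x μ) (iEta η A (x + e μ) κ) - iEta η A x κ = ((Complex.I : ℂ) * η * η) • covDerivFwd η W μ (fun z => A z κ) x := by
  unfold covDerivFwd iEta Ad conjR
  dsimp only
  have hc : ((Complex.I : ℂ) * η * η) * ((η⁻¹ : ℝ) : ℂ) = (Complex.I : ℂ) * η := by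
    rw [Complex.ofReal_inv, mul_assoc, mul_inv_cancel₀ (by exact_mod_cast hη : (η : ℂ) ≠ 0), mul_one]
  rw [← Complex.coe_smul, smul_smul, hc, smul_sub, mul_smul_comm, smul_mul_assoc]

/-- … hence `‖Ad_{W(x,μ)}(iEta η A)(x+e_μ,κ) − (iEta η A)(x,κ)‖ = η²·‖covDerivFwd η W μ (A · κ) x‖` (`η > 0`). [folklore] -/
theorem norm_Ad_iEta_sub {η : ℝ} (hη : 0 < η) (W : Site d → Fin d → (Matrix n n ℂ)ˣ) (A : Site d → Fin d → Matrix n n ℂ)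
    (μ : Fin d) (x : Site d) (κ : Fin d) :
    ‖Ad (W x μ) (iEta η A (x + e μ) κ) - iEta η A x κ‖ = η ^ 2 * ‖covDerivFwd η W μ (fun z => A z κ) x‖ := by
  rw [Ad_iEta_sub_eq_covDerivFwd hη.ne', norm_smul, norm_mul, norm_mul, Complex.norm_I, one_mul, Complex.norm_real, Real.norm_eq_abs,
    abs_of_pos hη, sq]

/-! ## §4 The package: from Theorem 4's output letters to the END's `rep ∕ skew ∕ sup ∕ grad` -/

/-- **FROM THE LEFT CHART TO THE END FRAME.**  Let `W` be unitary with plaquettes within `a` of `1`, `v` a site gauge, `A` a self-adjoint bond field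
with `U_A^{v} = e^{iηA}·W` bondwise (B8: `W₁ = cfgExp η A`, `W₁·W = gaugeAct v U_A`, cf. §1), `‖A x μ‖ ≤ s` ((1.62)∕(1.36)₁ at the top level) and
`‖covDerivFwd η W μ (A · κ) x‖ ≤ g` ((1.36)₂).  Then `Z := Ad_{W⁻¹}(iEta η A)` is END-framed for the pair: `gaugeAct v U_A = vary W Z 1`, `Z` is
`𝔲(N)`-valued, `‖Z x μ‖ ≤ η·s`, and `‖covDiff W μ Z x κ‖ ≤ η²·g + 2a·(η·s)`. [folklore] -/
theorem endFrame_of_leftChart [Nonempty n] {W UA : Site d → Fin d → (Matrix n n ℂ)ˣ} (hW : IsUnitaryCfg W) {a : ℝ} (ha : 0 ≤ a)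
    (hWa : SmallField W a) {v : Site d → (Matrix n n ℂ)ˣ} {η : ℝ} (hη : 0 < η) {A : Site d → Fin d → Matrix n n ℂ}
    (hAsa : ∀ x μ, IsSelfAdjoint (A x μ)) (hrep : ∀ x μ, gaugeAct v UA x μ = cfgExp η A x μ * W x μ) {s g : ℝ}
    (hs : ∀ x μ, ‖A x μ‖ ≤ s) (hg : ∀ (μ : Fin d) (x : Site d) (κ : Fin d), ‖covDerivFwd η W μ (fun z => A z κ) x‖ ≤ g) :
    gaugeAct v UA = vary W (fun x μ => Ad (W x μ)⁻¹ (iEta η A x μ)) 1 ∧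
      IsSkewDir (fun x μ => Ad (W x μ)⁻¹ (iEta η A x μ)) ∧
      (∀ x μ, ‖Ad (W x μ)⁻¹ (iEta η A x μ)‖ ≤ η * s) ∧
      (∀ (κ : Fin d) (x : Site d) (μ : Fin d), ‖covDiff W μ (fun x μ => Ad (W x μ)⁻¹ (iEta η A x μ)) x κ‖ ≤ η ^ 2 * g + 2 * a * (η * s)) := by
  refine ⟨?_, isSkewDir_AdInv hW (isSkewDir_iEta η hAsa), fun x μ => ?_, fun κ x μ => ?_⟩
  · rw [vary_AdInv_eq_expMul]
    funext x μ
    rw [hrep x μ, cfgExp_eq_expUnit_iEta]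
  · rw [norm_AdInv W hW, norm_iEta hη.le]
    exact mul_le_mul_of_nonneg_left (hs x μ) hη.le
  · have hP : ‖((hol W x (plaqWord κ μ) : (Matrix n n ℂ)ˣ) : Matrix n n ℂ) - 1‖ ≤ a := by
      by_cases hκμ : κ = μ
      · subst hκμ
        have h1 : hol W x (plaqWord κ κ) = 1 := by
          rw [← lplaqWord_true, hol_lplaqWord]
          simp only [stepHol_true, Letter.vec_true]
          group
        rw [h1, Units.val_one, sub_self, norm_zero]
        exact ha
      · exact hWa x κ μ hκμ
    have hY : ‖iEta η A (x + e μ) κ‖ ≤ η * s := by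
      rw [norm_iEta hη.le]; exact mul_le_mul_of_nonneg_left (hs _ _) hη.le
    calc ‖covDiff W μ (fun x μ => Ad (W x μ)⁻¹ (iEta η A x μ)) x κ‖
        ≤ ‖Ad (W x μ) (iEta η A (x + e μ) κ) - iEta η A x κ‖ + 2 * a * ‖iEta η A (x + e μ) κ‖ := norm_covDiff_AdInv_le hW _ μ x κ hP
      _ ≤ η ^ 2 * g + 2 * a * (η * s) := by
          rw [norm_Ad_iEta_sub hη]
          have h1 : η ^ 2 * ‖covDerivFwd η W μ (fun z => A z κ) x‖ ≤ η ^ 2 * g := mul_le_mul_of_nonneg_left (hg μ x κ) (by positivity)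
          have h2 : 2 * a * ‖iEta η A (x + e μ) κ‖ ≤ 2 * a * (η * s) := mul_le_mul_of_nonneg_left hY (by positivity)
          linarith

end

end Summit.QuantumFields.BalabanUV.T4Continuum.NE3.PairLeftChartB8
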